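import Literature.NumberTheory.LFunctions.GranvilleSoundararajan2003
import Literature.NumberTheory.LFunctions.HalaszEulerProduct
import Literature.NumberTheory.LFunctions.PoissonSmoothing
import Mathlib.Analysis.SumIntegralComparisons
import HarnessLib

/-!
# Granville–Soundararajan 2003, §4: the Euler product `F(s)` as a Dirichlet series, (4.1)–(4.2)

Seventh file of the proof of Theorem 1 of Granville–Soundararajan (sharp Halász).  The function
`F(s) = ∏_{p ≤ x} (1 + f(p)/p^s + f(p²)/p^{2s} + …)` of Theorem 1
(`GranvilleSoundararajan.truncEulerProduct`) is identified, for multiplicative `1`-bounded `f` and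
`Re s > 0`, with the Dirichlet series `∑ f̃(n) n^{-s}` of the `(⌊x⌋+1)`-smooth truncation `f̃`
(`Halasz.smoothCut`), by Mathlib's Euler product over smooth numbers; and we record the inputs of
§4 of the paper:
* `|F(1+iy)| ≤ ∏_{p ≤ x} (1 - 1/p)⁻¹`, whence `maxModulus f x T` is a genuine bounded supremum
  (`le_maxModulus`, `maxModulus_le_prod`);
* (4.1): `|F(1+α+iy)| ≤ ζ(1+α) ≤ 1 + 1/α` (`norm_LSeries_smoothCut_le_one_add_inv`);
* (4.2): for `|y| ≤ T`, `|F(1+α+iy)| ≤ max_{|u| ≤ 2T} |F(1+iu)| + (2α/T) e⁵ log x`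
  (`norm_F_shift_le`, Poisson smoothing = Lemma 2.2 of the paper, with `∑ |f̃(n)|/n ≤ e⁵ log x`).

## References
- [GranvilleSoundararajan2003] A. Granville, K. Soundararajan, *Decay of mean values of
  multiplicative functions*, Canad. J. Math. 55 (2003), §4, (4.1)–(4.2), arXiv math/9911246 p. 8.
-/

noncomputable section

open Finset Real Complex

namespace Literature.NumberTheory.LFunctions

namespace GranvilleSoundararajan

open Halasz (smoothCut smoothCut_of_mem smoothCut_of_not_mem norm_smoothCut_le)

/-! ### `F(s) = ∑ f̃(n) n^{-s}` -/

/-- **The truncated Euler product is the Dirichlet series of the smooth truncation**: for a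
multiplicative `f` with `|f| ≤ 1` and `Re s > 0`,
`∏_{p ≤ x} ∑_k f(p^k) p^{-ks} = ∑_{p ∣ n ⇒ p ≤ x} f(n) n^{-s}`.
[cite: GranvilleSoundararajan2003, §3b ("so that `F(s) = ∑_{n ≥ 1} f̃(n)/n^s`")] -/
theorem truncEulerProduct_eq_LSeries (f : ArithmeticFunction ℂ) (hf : f.IsMultiplicative)
    (hfb : ∀ n, ‖f n‖ ≤ 1) (x : ℝ) {s : ℂ} (hs : 0 < s.re) :
    truncEulerProduct (⇑f) x s = LSeries (smoothCut (⇑f) ⌊x⌋₊) s := by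
  set N := ⌊x⌋₊ with hN
  set g : ℕ → ℂ := fun n => f n * (n : ℂ) ^ (-s) with hg
  have hg1 : g 1 = 1 := by simp [hg, hf.map_one]
  have hgmul : ∀ {m n : ℕ}, Nat.Coprime m n → g (m * n) = g m * g n := by
    intro m n hmn
    simp only [hg]
    rw [hf.map_mul_of_coprime hmn, Nat.cast_mul, Complex.natCast_mul_natCast_cpow]
    ring
  have hgpow : ∀ (p k : ℕ), g (p ^ k) = f (p ^ k) * (p : ℂ) ^ (-(s * k)) := by
    intro p k
    simp only [hg]
    rw [Nat.cast_pow, ← Complex.natCast_cpow_natCast_mul]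
    congr 2; ring
  have hgsum : ∀ {p : ℕ}, p.Prime → Summable (fun k : ℕ => ‖g (p ^ k)‖) := by
    intro p hp
    simp_rw [hgpow]
    have hp2 : 2 ≤ p := hp.two_le
    have hp1 : (1 : ℝ) < p := by exact_mod_cast hp.one_lt
    have hr : (p : ℝ) ^ (-s.re) < 1 := Real.rpow_lt_one_of_one_lt_of_neg hp1 (by linarith)
    have hr0 : 0 ≤ (p : ℝ) ^ (-s.re) := Real.rpow_nonneg (by positivity) _
    exact Summable.of_nonneg_of_le (fun k => norm_nonneg _) (norm_term_le hfb hp2 s)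
      (summable_geometric_of_lt_one hr0 hr)
  obtain ⟨-, hhas⟩ := EulerProduct.summable_and_hasSum_smoothNumbers_prod_primesBelow_tsum hg1 hgmul hgsum (N + 1)
  -- the left side
  have hL : truncEulerProduct (⇑f) x s = ∏ p ∈ Nat.primesBelow (N + 1), ∑' k : ℕ, g (p ^ k) := by
    unfold truncEulerProduct eulerFactor
    refine Finset.prod_congr rfl fun p _ => tsum_congr fun k => (hgpow p k).symm
  -- the right side
  have hR : LSeries (smoothCut (⇑f) N) s = ∑' m : Nat.smoothNumbers (N + 1), g m := by
    rw [LSeries, tsum_subtype (Nat.smoothNumbers (N + 1)) g]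
    refine tsum_congr fun n => ?_
    by_cases h : n ∈ Nat.smoothNumbers (N + 1)
    · rw [Set.indicator_of_mem h, LSeries.term_of_ne_zero (Nat.ne_zero_of_mem_smoothNumbers h),
        smoothCut_of_mem h]
      simp only [hg]
      rw [Complex.cpow_neg, div_eq_mul_inv]
    · rw [Set.indicator_of_notMem h]
      rcases Nat.eq_zero_or_pos n with rfl | hn
      · exact LSeries.term_zero _ _
      · rw [LSeries.term_of_ne_zero hn.ne', smoothCut_of_not_mem h, zero_div]
  rw [hL, hR, hhas.tsum_eq]

/-! ### `|F(1+iy)| ≤ ∏ (1 - 1/p)⁻¹` and the supremum `maxModulus` -/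

/-- `|F(1+iy)| ≤ ∏_{p ≤ x} (1 - 1/p)⁻¹` for `|f| ≤ 1`. [cite: GranvilleSoundararajan2003, §4 ("`L ≤ (1/log x) ∏_{p≤x} (1-1/p)⁻¹`")] -/
theorem norm_truncEulerProduct_one_line_le {f : ℕ → ℂ} (hfb : ∀ n, ‖f n‖ ≤ 1) (x y : ℝ) :
    ‖truncEulerProduct f x (1 + y * I)‖ ≤ ∏ p ∈ Nat.primesLE ⌊x⌋₊, (1 - (p : ℝ)⁻¹)⁻¹ := by
  unfold truncEulerProduct
  rw [show Nat.primesBelow (⌊x⌋₊ + 1) = Nat.primesLE ⌊x⌋₊ from rfl]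
  refine (Finset.norm_prod_le _ _).trans (Finset.prod_le_prod (fun p _ => norm_nonneg _) fun p hp => ?_)
  have hpp := (Nat.mem_primesLE.mp hp).2
  have hp2 : 2 ≤ p := hpp.two_le
  have hp0 : (0 : ℝ) < p := by exact_mod_cast hpp.pos
  have hs : (0 : ℝ) < (1 + y * I : ℂ).re := by simp
  have hre : (1 + y * I : ℂ).re = 1 := by simp
  have hr0 : 0 ≤ (p : ℝ)⁻¹ := by positivity
  have hr1 : (p : ℝ)⁻¹ < 1 := inv_lt_one_of_one_lt₀ (by exact_mod_cast hpp.one_lt)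
  have hsum := summable_eulerFactor hfb hp2 hs
  unfold eulerFactor
  refine (norm_tsum_le_tsum_norm hsum.norm).trans ?_
  have hle : ∀ k : ℕ, ‖f (p ^ k) * (p : ℂ) ^ (-((1 + y * I) * k))‖ ≤ ((p : ℝ)⁻¹) ^ k := by
    intro k
    have h := norm_term_le hfb hp2 (1 + y * I) k
    rwa [hre, Real.rpow_neg_one] at h
  calc ∑' k : ℕ, ‖f (p ^ k) * (p : ℂ) ^ (-((1 + y * I) * k))‖ ≤ ∑' k : ℕ, ((p : ℝ)⁻¹) ^ k :=
        hsum.norm.tsum_le_tsum hle (summable_geometric_of_lt_one hr0 hr1)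
    _ = (1 - (p : ℝ)⁻¹)⁻¹ := tsum_geometric_of_lt_one hr0 hr1

/-- The set defining `maxModulus` is bounded above (by `∏ (1 - 1/p)⁻¹`). [folklore] -/
theorem bddAbove_maxModulus_set {f : ℕ → ℂ} (hfb : ∀ n, ‖f n‖ ≤ 1) (x T : ℝ) :
    BddAbove ((fun y : ℝ => ‖truncEulerProduct f x (1 + y * I)‖) '' Set.Icc (-(2 * T)) (2 * T)) := by
  refine ⟨∏ p ∈ Nat.primesLE ⌊x⌋₊, (1 - (p : ℝ)⁻¹)⁻¹, ?_⟩
  rintro b ⟨y, -, rfl⟩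
  exact norm_truncEulerProduct_one_line_le hfb x y

/-- `|F(1+iy)| ≤ maxModulus f x T` for `|y| ≤ 2T`. [cite: GranvilleSoundararajan2003, (1.3)] -/
theorem le_maxModulus {f : ℕ → ℂ} (hfb : ∀ n, ‖f n‖ ≤ 1) (x T : ℝ) {y : ℝ} (hy : |y| ≤ 2 * T) :
    ‖truncEulerProduct f x (1 + y * I)‖ ≤ maxModulus f x T :=
  le_csSup (bddAbove_maxModulus_set hfb x T) ⟨y, abs_le.mp hy, rfl⟩

/-- `maxModulus f x T ≤ ∏_{p ≤ x} (1 - 1/p)⁻¹` (`T ≥ 0`). [cite: GranvilleSoundararajan2003, §4] -/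
theorem maxModulus_le_prod {f : ℕ → ℂ} (hfb : ∀ n, ‖f n‖ ≤ 1) (x : ℝ) {T : ℝ} (hT : 0 ≤ T) :
    maxModulus f x T ≤ ∏ p ∈ Nat.primesLE ⌊x⌋₊, (1 - (p : ℝ)⁻¹)⁻¹ := by
  refine csSup_le ⟨_, ⟨0, ⟨by linarith, by linarith⟩, rfl⟩⟩ ?_
  rintro b ⟨y, -, rfl⟩
  exact norm_truncEulerProduct_one_line_le hfb x y

/-- `0 ≤ maxModulus f x T` (`T ≥ 0`). [folklore] -/
theorem maxModulus_nonneg {f : ℕ → ℂ} (hfb : ∀ n, ‖f n‖ ≤ 1) (x : ℝ) {T : ℝ} (hT : 0 ≤ T) :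
    0 ≤ maxModulus f x T :=
  (norm_nonneg _).trans (le_maxModulus hfb x T (y := 0) (by rw [abs_zero]; linarith))

/-! ### (4.1): `|F(1+α+iy)| ≤ ζ(1+α) ≤ 1 + 1/α` -/

/-- `∑_{n ≤ M} n^{-(1+α)} ≤ 1 + 1/α` (`α > 0`), by comparison with `∫_1^M t^{-1-α} dt ≤ 1/α`.
[folklore] -/
theorem sum_range_rpow_neg_le (α : ℝ) (hα : 0 < α) (M : ℕ) :
    ∑ n ∈ Finset.range M, (if n = 0 then (0 : ℝ) else (n : ℝ) ^ (-(1 + α))) ≤ 1 + 1 / α := by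
  rcases Nat.lt_or_ge M 2 with hM | hM
  · interval_cases M
    · simp; positivity
    · simp; positivity
  have h1 : Finset.range M = insert 0 (Finset.Ico 1 M) := by
    ext n; simp only [Finset.mem_range, Finset.mem_insert, Finset.mem_Ico]; omega
  rw [h1, Finset.sum_insert (by simp), if_pos rfl, zero_add,
    Finset.sum_eq_sum_Ico_succ_bot (by omega : 1 < M), if_neg one_ne_zero, Nat.cast_one, Real.one_rpow]
  have h3 : ∑ k ∈ Finset.Ico (1 + 1) M, (if k = 0 then (0 : ℝ) else (k : ℝ) ^ (-(1 + α))) =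
      ∑ i ∈ Finset.Ico 1 (M - 1), ((i + 1 : ℕ) : ℝ) ^ (-(1 + α)) := by
    conv_lhs => rw [show M = M - 1 + 1 by omega]
    rw [← Finset.sum_Ico_add' (fun k : ℕ => if k = 0 then (0 : ℝ) else (k : ℝ) ^ (-(1 + α))) 1 (M - 1) 1]
    refine Finset.sum_congr rfl fun i _ => ?_
    rw [if_neg (by omega)]
  rw [h3]
  gcongr
  have hM1 : (1 : ℝ) ≤ ((M - 1 : ℕ) : ℝ) := by exact_mod_cast (show 1 ≤ M - 1 by omega)
  have hanti : AntitoneOn (fun t : ℝ => t ^ (-(1 + α))) (Set.Icc ((1 : ℕ) : ℝ) ((M - 1 : ℕ) : ℝ)) := by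
    intro a ha b _ hab
    have ha1 : (0 : ℝ) < a := by
      have : ((1 : ℕ) : ℝ) ≤ a := ha.1
      push_cast at this; linarith
    exact Real.rpow_le_rpow_of_nonpos ha1 hab (by linarith)
  have hcmp := AntitoneOn.sum_le_integral_Ico (f := fun t : ℝ => t ^ (-(1 + α))) (by omega : 1 ≤ M - 1) hanti
  refine hcmp.trans ?_
  have h0 : (0 : ℝ) ∉ Set.uIcc ((1 : ℕ) : ℝ) ((M - 1 : ℕ) : ℝ) := by
    rw [Nat.cast_one, Set.uIcc_of_le hM1]
    intro h
    exact absurd h.1 (by norm_num)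
  rw [integral_rpow (Or.inr ⟨by intro h; linarith, h0⟩), Nat.cast_one,
    show -(1 + α) + 1 = -α by ring, Real.one_rpow]
  have hpos : 0 < ((M - 1 : ℕ) : ℝ) ^ (-α) := Real.rpow_pos_of_pos (by linarith) _
  rw [div_neg, ← neg_div, neg_sub, div_le_div_iff_of_pos_right hα]
  linarith

/-- **(4.1)**: `|F(1+α+iy)| ≤ ∑_{p∣n ⇒ p ≤ x} n^{-1-α} ≤ ζ(1+α) ≤ 1 + 1/α` for `|f| ≤ 1`, `α > 0`.
[cite: GranvilleSoundararajan2003, (4.1)] -/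
theorem norm_LSeries_smoothCut_le_one_add_inv {f : ℕ → ℂ} (hfb : ∀ n, ‖f n‖ ≤ 1) (N : ℕ)
    {α : ℝ} (hα : 0 < α) (y : ℝ) :
    ‖LSeries (smoothCut f N) (1 + α + y * I)‖ ≤ 1 + 1 / α := by
  have hle : ∀ n : ℕ, ‖LSeries.term (smoothCut f N) (1 + α + y * I) n‖ ≤
      (if n = 0 then (0 : ℝ) else (n : ℝ) ^ (-(1 + α))) := by
    intro n
    rcases Nat.eq_zero_or_pos n with rfl | hn
    · simp
    · rw [if_neg hn.ne', LSeries.term_of_ne_zero hn.ne', norm_div, Complex.norm_natCast_cpow_of_pos hn]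
      simp only [Complex.add_re, Complex.one_re, Complex.ofReal_re, Complex.mul_re, Complex.I_re,
        Complex.ofReal_im, Complex.I_im, mul_zero, mul_one, sub_self, add_zero]
      rw [Real.rpow_neg (Nat.cast_nonneg n), div_eq_mul_inv]
      exact mul_le_of_le_one_left (by positivity) (norm_smoothCut_le hfb n)
  have hpart : ∀ M : ℕ, ∑ n ∈ Finset.range M, ‖LSeries.term (smoothCut f N) (1 + α + y * I) n‖ ≤ 1 + 1 / α :=
    fun M => (Finset.sum_le_sum fun n _ => hle n).trans (sum_range_rpow_neg_le α hα M)
  have hsum : Summable fun n => ‖LSeries.term (smoothCut f N) (1 + α + y * I) n‖ :=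
    summable_of_sum_range_le (fun n => norm_nonneg _) hpart
  calc ‖LSeries (smoothCut f N) (1 + α + y * I)‖ ≤ ∑' n, ‖LSeries.term (smoothCut f N) (1 + α + y * I) n‖ :=
        norm_tsum_le_tsum_norm hsum
    _ ≤ 1 + 1 / α := Real.tsum_le_of_sum_range_le (fun n => norm_nonneg _) hpart

/-! ### (4.2): transport from the line `Re s = 1` -/

/-- **(4.2)** for multiplicative `1`-bounded `f`: for `x ≥ 3`, `T > 0`, `α > 0` and `|y| ≤ T`,
`|F(1+α+iy)| ≤ max_{|u| ≤ 2T} |F(1+iu)| + (2α/T) e⁵ log x`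
(Lemma 2.2 = `PoissonSmoothing.norm_LSeries_le_of_bound`, with `∑ |f̃(n)|/n ≤ e⁵ log x`).
[cite: GranvilleSoundararajan2003, (4.2)] -/
theorem norm_F_shift_le (f : ArithmeticFunction ℂ) (hf : f.IsMultiplicative) (hfb : ∀ n, ‖f n‖ ≤ 1)
    {x : ℝ} (hx : 3 ≤ x) {T : ℝ} (hT : 0 < T) {α : ℝ} (hα : 0 < α) {y : ℝ} (hy : |y| ≤ T) :
    ‖LSeries (smoothCut (⇑f) ⌊x⌋₊) (1 + α + y * I)‖ ≤
      maxModulus (⇑f) x T + 2 * α / T * (Real.exp 5 * Real.log x) := by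
  obtain ⟨hsum, hS⟩ := Halasz.tsum_norm_term_one_le (g := ⇑f) hfb hx
  have hP := PoissonSmoothing.norm_LSeries_le_of_bound (α := α) hα (a := smoothCut (⇑f) ⌊x⌋₊)
    (σ₀ := 1) hsum hT y (B := maxModulus (⇑f) x T)
    (fun u hu => by
      have hu2 : |u| ≤ 2 * T := by linarith [abs_nonneg y]
      have h := le_maxModulus hfb x T hu2
      rw [truncEulerProduct_eq_LSeries f hf hfb x (by simp : (0:ℝ) < (1 + u * I : ℂ).re)] at h
      simpa using h)
  push_cast at hP
  refine hP.trans ?_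
  have : 0 ≤ 2 * α / T := by positivity
  nlinarith

end GranvilleSoundararajan

end Literature.NumberTheory.LFunctions
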